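import Summits.QuantumFields.YangMills.Theorems.BalabanLadderNTCumulantPolarisationDefs
import HarnessLib

/-!
# Crux `NT` / seam `UVSeamRec.stub_floorsEngine` (S-B): CUMULANT POLARISATION — the clause-(ii) floor in mirror shape
# and a four-point ceiling give the bare mirror floor MF EXACTLY (card `cumulant-polarisation`, kernel-checked)

Helper file (`--supports stmt-QuantumFields-20043`; owner RULINGS R78/R87) of the fleet lead `ym-spine-19353-p1`,
sequel of `…NTCumulantPolarisationDefs` (crux-ideate card 10, seat `ym-cruxidea-19353-2`).
WHICH CLAUSE IT SUPPLIES: the R87 residual **MF(4ε)** of conjunct 2 of the REGISTERED `UVSeamRec.stub_floorsEngine`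
(consumed by p517197 / p518416) FROM the clause-(ii) = conjunct-3 floor taken in MIRROR SHAPE plus a size-only
four-point ceiling — the two sign-sensitive floors of the residual of record {BL6, MF, (ii)} collapse to ONE.

* §1 `Q3_theta_theta_eq_sum_cube`, **`Q3_theta_theta_eq_mirrorForm`** — the EXACT lattice identity
  `Q3 G r β L s v (θg) (θh) = B(P, Ṽ_v)`, `P = (Wᴿ_g − ⟨Wᴿ_g⟩)(Wᴿ_h − ⟨Wᴿ_h⟩)` (re-indexing over the symmetric box,
  site chirality `dens_siteReflect`, `torusCum3_eq_cov_centred`); no `O(s)` term.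
* §2 `sq_mirrorForm_cprod_le` — RPCS `B(P, Ṽ)² ≤ B(P, P)·B(Ṽ, Ṽ)` (tree `Reflection.sq_cov_negReflect_le_odd_pos`;
  `P`, `Ṽ` are positive-half cylinder observables); `mirrorForm_cubeSmear_self_nonneg` — `0 ≤ B(Ṽ, Ṽ)`
  (`ConjugateResponse.cov_negReflect_self_nonneg`).
* §3 `floor_transfer_arith`, **`bareFloor_of_Q3_floor`** — per coupling and torus: `ε₃ ≤ |Q3(v, θg, θh)|` and
  `B(P, P) ≤ M` force `0 < M` and `ε₃²/M ≤ Cov_T(Ṽ_v∘Θ₀, Ṽ_v)` = MF with `4ε = ε₃²/M`.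
General compact `G`, any `r`, `β ≥ 0`, every odd torus.

HONEST FRAMING.  Exact identities + RP; the (ii)-floor (a `g⋆⁴`-sized connected three-point floor at physical
separations) and the four-point ceiling (MomentBounds-class, size only) are engine-grade OPEN; nothing about NT, the seam
or a gap. [cite: FrohlichIsraelLiebSimon1978, Thm. 2.1; OsterwalderSeiler1978, §2; GlimmJaffe1987, §19.1]
-/

set_option autoImplicit false

noncomputable section

open scoped SchwartzMap
open MeasureTheory Filter Topology
open Literature.MathematicalPhysics.QuantumFieldTheory Literature.MathematicalPhysics.QuantumLattice
open Literature.Probability.LatticeModels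
open Summit.QuantumFields.YangMills.Cruxes.OSLegsFromFemtoAndGap.DlrCollarTransfer
open Summit.QuantumFields.YangMills.Cruxes.OSLegsFromFemtoAndGap.DlrCollarTransfer.StubLower (mem_cubeSites_iff)
open Summit.QuantumFields.YangMills.Cruxes.NT.Reflection
open Summit.QuantumFields.YangMills.Cruxes.NT.MarkovMirror
open Summit.QuantumFields.YangMills.Cruxes.NT.ConjugateResponse (torusE_comp_cfgReflect cov_negReflect_self_nonneg)

namespace Summit.QuantumFields.YangMills.Cruxes.NT.CumulantPolarisation

/-! ## §1 The exact identity `Q3(v, θg, θh) = B(P, Ṽ_v)` -/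

section Identity

variable (G : Type) [Group G] [TopologicalSpace G] [IsTopologicalGroup G] [CompactSpace G]
  [MeasurableSpace G] [BorelSpace G] (r : LatticeRep G)

/-- **Re-indexing and restriction.**  For test functions `v, g, h` at spacing `s` with lattice supports in a cube
`Q ⊆ box 4 L`: `Q3 G r β L s v (θg) (θh) = Σ_{x,y,z ∈ Q} v(sx) g(sy) h(sz) · torusK3 x (θ₀y) (θ₀z)` (re-index
`y, z ↦ θ₀y, θ₀z` over the symmetric box, `(θg)(s·θ₀y) = g(s·y)`). [folklore] -/
theorem Q3_theta_theta_eq_sum_cube (β : ℝ) (L : ℕ) (s : ℝ) (v g h : 𝓢(EuclideanSpace ℝ (Fin 4), ℝ))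
    (c : Fin 4 → ℤ) (b : ℕ) (hsub : cubeSites c b ⊆ box 4 L)
    (hv : ∀ x : Fin 4 → ℤ, v (s • siteToE x) ≠ 0 → x ∈ cubeSites c b)
    (hg : ∀ y : Fin 4 → ℤ, g (s • siteToE y) ≠ 0 → y ∈ cubeSites c b)
    (hh : ∀ z : Fin 4 → ℤ, h (s • siteToE z) ≠ 0 → z ∈ cubeSites c b) :
    Q3 G r β L s v (thetaTest 4 g) (thetaTest 4 h) =
      ∑ x ∈ cubeSites c b, ∑ y ∈ cubeSites c b, ∑ z ∈ cubeSites c b,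
        v (s • siteToE x) * g (s • siteToE y) * h (s • siteToE z) * torusK3 G r β L x (siteReflect y) (siteReflect z) := by
  unfold Q3
  have hz : ∀ x y : Fin 4 → ℤ,
      ∑ z ∈ box 4 L, v (s • siteToE x) * thetaTest 4 g (s • siteToE y) * thetaTest 4 h (s • siteToE z) *
          torusK3 G r β L x y z =
        ∑ z ∈ box 4 L, v (s • siteToE x) * thetaTest 4 g (s • siteToE y) * h (s • siteToE z) *
          torusK3 G r β L x y (siteReflect z) := by
    intro x y
    rw [← sum_box_siteReflect L (fun z => v (s • siteToE x) * thetaTest 4 g (s • siteToE y) * h (s • siteToE z) *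
      torusK3 G r β L x y (siteReflect z))]
    refine Finset.sum_congr rfl fun z _ => ?_
    simp only [thetaTest_apply, timeReflection_smul_siteToE, siteReflect_siteReflect]
  have hy : ∀ x : Fin 4 → ℤ,
      ∑ y ∈ box 4 L, ∑ z ∈ box 4 L, v (s • siteToE x) * thetaTest 4 g (s • siteToE y) * h (s • siteToE z) *
          torusK3 G r β L x y (siteReflect z) =
        ∑ y ∈ box 4 L, ∑ z ∈ box 4 L, v (s • siteToE x) * g (s • siteToE y) * h (s • siteToE z) *
          torusK3 G r β L x (siteReflect y) (siteReflect z) := by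
    intro x
    rw [← sum_box_siteReflect L (fun y => ∑ z ∈ box 4 L, v (s • siteToE x) * g (s • siteToE y) * h (s • siteToE z) *
      torusK3 G r β L x (siteReflect y) (siteReflect z))]
    refine Finset.sum_congr rfl fun y _ => ?_
    simp only [thetaTest_apply, timeReflection_smul_siteToE, siteReflect_siteReflect]
  rw [Finset.sum_congr rfl fun x _ => Finset.sum_congr rfl fun y _ => hz x y]
  rw [Finset.sum_congr rfl fun x _ => hy x]
  -- restrict the three sums to the cube
  symm
  refine Eq.trans (Finset.sum_subset hsub fun x _ hx => ?_) (Finset.sum_congr rfl fun x _ => ?_)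
  · have h0 : v (s • siteToE x) = 0 := by by_contra h0; exact hx (hv x h0)
    exact Finset.sum_eq_zero fun y _ => Finset.sum_eq_zero fun z _ => by rw [h0]; ring
  refine Eq.trans (Finset.sum_subset hsub fun y _ hy0 => ?_) (Finset.sum_congr rfl fun y _ => ?_)
  · have h0 : g (s • siteToE y) = 0 := by by_contra h0; exact hy0 (hg y h0)
    exact Finset.sum_eq_zero fun z _ => by rw [h0]; ring
  exact Finset.sum_subset hsub fun z _ hz0 => by
    have h0 : h (s • siteToE z) = 0 := by by_contra h0; exact hz0 (hh z h0)
    rw [h0]; ring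

/-- **Cumulant polarisation — the exact lattice identity.**  For test functions `v, g, h` at spacing `s` whose lattice
supports sit in one cube `Q = (c, b) ⊆ box 4 L`:
`Q3 G r β L s v (θg) (θh) = B(P, Ṽ_v)` with `P = (Wᴿ_g − ⟨Wᴿ_g⟩)(Wᴿ_h − ⟨Wᴿ_h⟩)` the centred product of the two
reflected-species smearings, `Ṽ_v = Σ_x v(sx) dens_x`, and `B(X, Y) = Cov_T(X∘Θ₀, Y)` the mirror form.  EXACT — no
`O(s)` term: `torusK3 x (θ₀y) (θ₀z) = κ₃(dens_x, dens_{θ₀y}, dens_{θ₀z})`, the third cumulant is the covariance of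
`dens_x` against the centred product (`torusCum3_eq_cov_centred`), and `dens_{θ₀y} = (Σ_q plane_q(y_q))∘Θ₀`
(`dens_siteReflect`). [folklore] -/
theorem Q3_theta_theta_eq_mirrorForm (β : ℝ) (L : ℕ) (s : ℝ) (v g h : 𝓢(EuclideanSpace ℝ (Fin 4), ℝ))
    (c : Fin 4 → ℤ) (b : ℕ) (hsub : cubeSites c b ⊆ box 4 L)
    (hv : ∀ x : Fin 4 → ℤ, v (s • siteToE x) ≠ 0 → x ∈ cubeSites c b)
    (hg : ∀ y : Fin 4 → ℤ, g (s • siteToE y) ≠ 0 → y ∈ cubeSites c b)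
    (hh : ∀ z : Fin 4 → ℤ, h (s • siteToE z) ≠ 0 → z ∈ cubeSites c b) :
    Q3 G r β L s v (thetaTest 4 g) (thetaTest 4 h) =
      mirrorForm G r β L
        (cprod G r β L (reflSmear G r c b fun y => g (s • siteToE y)) (reflSmear G r c b fun z => h (s • siteToE z)))
        (cubeSmear G r c b fun x => v (s • siteToE x)) := by
  rw [Q3_theta_theta_eq_sum_cube G r β L s v g h c b hsub hv hg hh, mirrorForm_cprod_cubeSmear]
  have hK : ∀ x y z : Fin 4 → ℤ, torusK3 G r β L x (siteReflect y) (siteReflect z) =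
      torusE G r β L (fun V => (cdensR G r β L y V * cdensR G r β L z V) * dens G r x V) -
        torusE G r β L (fun V => cdensR G r β L y V * cdensR G r β L z V) * torusE G r β L (dens G r x) :=
    fun x y z => torusCum3_eq_cov_centred G r β L (continuous_dens r x) (continuous_dens r _) (continuous_dens r _)
  simp_rw [hK]
  rw [Finset.sum_product]
  conv_lhs => rw [Finset.sum_comm]
  refine Finset.sum_congr rfl fun y _ => ?_
  conv_lhs => rw [Finset.sum_comm]
  refine Finset.sum_congr rfl fun z _ => Finset.sum_congr rfl fun x _ => ?_
  ring

end Identity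

/-! ## §2 Reflection-positivity Cauchy–Schwarz and nonnegativity for the mirror form -/

section RP

variable (G : Type) [Group G] [TopologicalSpace G] [IsTopologicalGroup G] [CompactSpace G]
  [MeasurableSpace G] [BorelSpace G] (r : LatticeRep G)

/-- **RPCS for the mirror form of the centred product against a cube smearing.**  Cube `Q = (c, b)` at times `≥ 1`
with `c 0 + b + 1 ≤ L`; weights `wg, wh` at depth `≥ 2` (so `Wᴿ_{wg}, Wᴿ_{wh}` and their centred product `P` are
carried by `Q`); `wv` arbitrary.  Then `B(P, Ṽ_{wv})² ≤ B(P, P) · B(Ṽ_{wv}, Ṽ_{wv})` (`β ≥ 0`) — the tree's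
`Reflection.sq_cov_negReflect_le_odd_pos` for the positive-half torus observables `P∘lift`, `Ṽ∘lift`.
[cite: FrohlichIsraelLiebSimon1978, Thm. 2.1] -/
theorem sq_mirrorForm_cprod_le {β : ℝ} (hβ : 0 ≤ β) (c : Fin 4 → ℤ) (b L : ℕ) (hc0 : 1 ≤ c 0)
    (hcL : c 0 + (b : ℤ) + 1 ≤ L) (wg wh wv : (Fin 4 → ℤ) → ℝ)
    (hwg : ∀ x ∈ cubeSites c b, wg x ≠ 0 → 2 ≤ depth c b x)
    (hwh : ∀ x ∈ cubeSites c b, wh x ≠ 0 → 2 ≤ depth c b x) :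
    (mirrorForm G r β L (cprod G r β L (reflSmear G r c b wg) (reflSmear G r c b wh)) (cubeSmear G r c b wv)) ^ 2 ≤
      mirrorForm G r β L (cprod G r β L (reflSmear G r c b wg) (reflSmear G r c b wh))
          (cprod G r β L (reflSmear G r c b wg) (reflSmear G r c b wh)) *
        mirrorForm G r β L (cubeSmear G r c b wv) (cubeSmear G r c b wv) := by
  classical
  haveI := r.secondCountableTopology
  set X : LGConfig 4 G → ℝ := cprod G r β L (reflSmear G r c b wg) (reflSmear G r c b wh) with hX
  set Y : LGConfig 4 G → ℝ := cubeSmear G r c b wv with hY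
  have hXc : Continuous X :=
    continuous_cprod G r β L (continuous_reflSmear' G r c b wg) (continuous_reflSmear' G r c b wh)
  have hYc : Continuous Y := continuous_cubeSmear' G r c b wv
  obtain ⟨MX, hMX⟩ := exists_abs_cprod_le G r β L (X := reflSmear G r c b wg) (Y := reflSmear G r c b wh)
    (exists_abs_reflSmear_le G r (cubeSites c b) wg) (exists_abs_reflSmear_le G r (cubeSites c b) wh)
  obtain ⟨MY, hMY⟩ := exists_abs_cubeSmear_le G r c b wv
  obtain ⟨Sg, hgS, hSg⟩ := exists_isCylinder_reflSmear G r c b wg hwg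
  obtain ⟨Sh, hhS, hSh⟩ := exists_isCylinder_reflSmear G r c b wh hwh
  have hXS : IsCylinder X (Sg ∪ Sh) := isCylinder_cprod G r β L hgS hhS
  have hSX : ∀ e ∈ Sg ∪ Sh, ∀ j, c j ≤ e.1 j ∧ e.1 j ≤ c j + b := fun e he j => by
    rcases Finset.mem_union.1 he with he | he
    · exact hSg e he j
    · exact hSh e he j
  obtain ⟨SY, hYS, hSY⟩ := exists_isCylinder_cubeSmear G r c b wv
  -- torus observables
  set F : GaugeConfig 4 (2 * L + 1) G → ℝ := fun U => X (torusLift (2 * L + 1) U) with hF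
  set H : GaugeConfig 4 (2 * L + 1) G → ℝ := fun U => Y (torusLift (2 * L + 1) U) with hH
  have hFc : Continuous F := hXc.comp (continuous_torusLift _)
  have hHc : Continuous H := hYc.comp (continuous_torusLift _)
  have hFb : ∀ U, |F U| ≤ MX := fun U => hMX _
  have hHb : ∀ U, |H U| ≤ MY := fun U => hMY _
  have hposF : DependsOn F {e : Edge 4 (2 * L + 1) | (e.1 0).val ≤ L ∧ ((e.1.shift e.2) 0).val ≤ L} :=
    dependsOn_posHalf_of_window L hXS fun e he => by
      have := hSX e he 0
      constructor <;> linarith [this.1, this.2]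
  have hposH : DependsOn H {e : Edge 4 (2 * L + 1) | (e.1 0).val ≤ L ∧ ((e.1.shift e.2) 0).val ≤ L} :=
    dependsOn_posHalf_of_window L hYS fun e he => by
      have := hSY e he 0
      constructor <;> linarith [this.1, this.2]
  have hL1 : 1 ≤ L := by
    have : (0 : ℤ) ≤ b := Int.natCast_nonneg b
    have : (1 : ℤ) ≤ L := by linarith
    exact_mod_cast this
  have hcs := sq_cov_negReflect_le_odd_pos (d := 4) (L := 2 * L + 1) r.ρ rfl hL1 r.continuous hβ
    hFc.measurable hHc.measurable ⟨MX, hFb⟩ ⟨MY, hHb⟩ hposF hposH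
  have hinvF : ∫ U, F U.negReflect ∂(wilsonMeasure (d := 4) (L := 2 * L + 1) r.ρ β) =
      ∫ U, F U ∂(wilsonMeasure (d := 4) (L := 2 * L + 1) r.ρ β) :=
    integral_comp_negReflect_eq (d := 4) (L := 2 * L + 1) r.ρ r.continuous β F
  have hinvH : ∫ U, H U.negReflect ∂(wilsonMeasure (d := 4) (L := 2 * L + 1) r.ρ β) =
      ∫ U, H U ∂(wilsonMeasure (d := 4) (L := 2 * L + 1) r.ρ β) :=
    integral_comp_negReflect_eq (d := 4) (L := 2 * L + 1) r.ρ r.continuous β H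
  unfold mirrorForm torusE
  simp only [← torusLift_negReflect]
  change ((∫ U, F U.negReflect * H U ∂(wilsonMeasure (d := 4) (L := 2 * L + 1) r.ρ β)) -
      (∫ U, F U.negReflect ∂(wilsonMeasure (d := 4) (L := 2 * L + 1) r.ρ β)) *
        (∫ U, H U ∂(wilsonMeasure (d := 4) (L := 2 * L + 1) r.ρ β))) ^ 2 ≤
    ((∫ U, F U.negReflect * F U ∂(wilsonMeasure (d := 4) (L := 2 * L + 1) r.ρ β)) -
      (∫ U, F U.negReflect ∂(wilsonMeasure (d := 4) (L := 2 * L + 1) r.ρ β)) *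
        (∫ U, F U ∂(wilsonMeasure (d := 4) (L := 2 * L + 1) r.ρ β))) *
    ((∫ U, H U.negReflect * H U ∂(wilsonMeasure (d := 4) (L := 2 * L + 1) r.ρ β)) -
      (∫ U, H U.negReflect ∂(wilsonMeasure (d := 4) (L := 2 * L + 1) r.ρ β)) *
        (∫ U, H U ∂(wilsonMeasure (d := 4) (L := 2 * L + 1) r.ρ β)))
  rw [hinvF, hinvH, ← pow_two, ← pow_two]
  exact hcs

/-- **Reflection positivity for the mirror form of a cube smearing**: `0 ≤ B(Ṽ_w, Ṽ_w) = Cov_T(Ṽ_w∘Θ₀, Ṽ_w)` for a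
cube at times `≥ 1` with `c 0 + b + 1 ≤ L` (`β ≥ 0`). [cite: OsterwalderSeiler1978, §2] -/
theorem mirrorForm_cubeSmear_self_nonneg {β : ℝ} (hβ : 0 ≤ β) (c : Fin 4 → ℤ) (b L : ℕ) (hc0 : 1 ≤ c 0)
    (hcL : c 0 + (b : ℤ) + 1 ≤ L) (w : (Fin 4 → ℤ) → ℝ) :
    0 ≤ mirrorForm G r β L (cubeSmear G r c b w) (cubeSmear G r c b w) := by
  classical
  haveI := r.secondCountableTopology
  set Y : LGConfig 4 G → ℝ := cubeSmear G r c b w with hY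
  have hYc : Continuous Y := continuous_cubeSmear' G r c b w
  obtain ⟨MY, hMY⟩ := exists_abs_cubeSmear_le G r c b w
  obtain ⟨SY, hYS, hSY⟩ := exists_isCylinder_cubeSmear G r c b w
  set H : GaugeConfig 4 (2 * L + 1) G → ℝ := fun U => Y (torusLift (2 * L + 1) U) with hH
  have hHc : Continuous H := hYc.comp (continuous_torusLift _)
  have hHb : ∀ U, |H U| ≤ MY := fun U => hMY _
  have hposH : DependsOn H {e : Edge 4 (2 * L + 1) | (e.1 0).val ≤ L ∧ ((e.1.shift e.2) 0).val ≤ L} :=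
    dependsOn_posHalf_of_window L hYS fun e he => by
      have := hSY e he 0
      constructor <;> linarith [this.1, this.2]
  have hL1 : 1 ≤ L := by
    have : (0 : ℤ) ≤ b := Int.natCast_nonneg b
    have : (1 : ℤ) ≤ L := by linarith
    exact_mod_cast this
  have hnn := cov_negReflect_self_nonneg r.ρ hL1 r.continuous hβ hHc.measurable ⟨MY, hHb⟩ hposH
  have hinvH : ∫ U, H U.negReflect ∂(wilsonMeasure (d := 4) (L := 2 * L + 1) r.ρ β) =
      ∫ U, H U ∂(wilsonMeasure (d := 4) (L := 2 * L + 1) r.ρ β) :=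
    integral_comp_negReflect_eq (d := 4) (L := 2 * L + 1) r.ρ r.continuous β H
  unfold mirrorForm torusE
  simp only [← torusLift_negReflect]
  change 0 ≤ (∫ U, H U.negReflect * H U ∂(wilsonMeasure (d := 4) (L := 2 * L + 1) r.ρ β)) -
    (∫ U, H U.negReflect ∂(wilsonMeasure (d := 4) (L := 2 * L + 1) r.ρ β)) *
      (∫ U, H U ∂(wilsonMeasure (d := 4) (L := 2 * L + 1) r.ρ β))
  rw [hinvH, ← pow_two]
  exact hnn

end RP

/-! ## §3 The transfer per coupling and torus: (ii)-mirror floor + four-point ceiling ⇒ bare mirror floor -/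

/-- Scalar endgame: `ε₃ ≤ |q|`, `q² ≤ P·X`, `P ≤ M`, `X ≥ 0`, `ε₃ > 0` give `ε₃²/M ≤ X` (and `M > 0`). [folklore] -/
theorem floor_transfer_arith {q P X M ε₃ : ℝ} (hε₃ : 0 < ε₃) (hq : ε₃ ≤ |q|) (hcs : q ^ 2 ≤ P * X) (hP : P ≤ M)
    (hX : 0 ≤ X) : 0 < M ∧ ε₃ ^ 2 / M ≤ X := by
  have hq2 : ε₃ ^ 2 ≤ q ^ 2 := by
    nlinarith [mul_nonneg (sub_nonneg.2 hq) (add_nonneg (abs_nonneg q) hε₃.le), sq_abs q]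
  have hPX : ε₃ ^ 2 ≤ P * X := hq2.trans hcs
  have hε2 : 0 < ε₃ ^ 2 := by positivity
  have hP0 : 0 < P := by
    by_contra hP0
    push Not at hP0
    have : P * X ≤ 0 := by nlinarith
    linarith
  have hM0 : 0 < M := lt_of_lt_of_le hP0 hP
  refine ⟨hM0, ?_⟩
  rw [div_le_iff₀ hM0]
  nlinarith

section Transfer

variable (G : Type) [Group G] [TopologicalSpace G] [IsTopologicalGroup G] [CompactSpace G]
  [MeasurableSpace G] [BorelSpace G] (r : LatticeRep G)

/-- **Cumulant polarisation, per coupling and torus.**  Cube `Q = (c, b) ⊆ box 4 L` at times `≥ 1` with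
`c 0 + b + 1 ≤ L`; test functions `v, g, h` at spacing `s` with lattice supports in `Q` (`g, h` at depth `≥ 2`);
`β ≥ 0`.  If `ε₃ ≤ |Q3 G r β L s v (θg) (θh)|` (the clause-(ii) floor in mirror shape, `ε₃ > 0`) and
`B(P, P) ≤ M` (four-point ceiling of the centred product `P` of the two reflected smearings), then `0 < M` and the bare
mirror floor holds: `ε₃²/M ≤ Cov_T(Ṽ_v∘Θ₀, Ṽ_v)`. [folklore] -/
theorem bareFloor_of_Q3_floor {β : ℝ} (hβ : 0 ≤ β) (c : Fin 4 → ℤ) (b L : ℕ) (hc0 : 1 ≤ c 0)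
    (hcL : c 0 + (b : ℤ) + 1 ≤ L) (hsub : cubeSites c b ⊆ box 4 L) (s : ℝ)
    (v g h : 𝓢(EuclideanSpace ℝ (Fin 4), ℝ))
    (hv : ∀ x : Fin 4 → ℤ, v (s • siteToE x) ≠ 0 → x ∈ cubeSites c b)
    (hg : ∀ y : Fin 4 → ℤ, g (s • siteToE y) ≠ 0 → y ∈ cubeSites c b ∧ 2 ≤ depth c b y)
    (hh : ∀ z : Fin 4 → ℤ, h (s • siteToE z) ≠ 0 → z ∈ cubeSites c b ∧ 2 ≤ depth c b z)
    {ε₃ M : ℝ} (hε₃ : 0 < ε₃) (hfloor : ε₃ ≤ |Q3 G r β L s v (thetaTest 4 g) (thetaTest 4 h)|)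
    (hceil : mirrorForm G r β L
        (cprod G r β L (reflSmear G r c b fun y => g (s • siteToE y)) (reflSmear G r c b fun z => h (s • siteToE z)))
        (cprod G r β L (reflSmear G r c b fun y => g (s • siteToE y)) (reflSmear G r c b fun z => h (s • siteToE z)))
        ≤ M) :
    0 < M ∧ ε₃ ^ 2 / M ≤
      mirrorForm G r β L (cubeSmear G r c b fun x => v (s • siteToE x)) (cubeSmear G r c b fun x => v (s • siteToE x)) := by
  have hid := Q3_theta_theta_eq_mirrorForm G r β L s v g h c b hsub hv (fun y hy => (hg y hy).1)
    (fun z hz => (hh z hz).1)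
  have hcs := sq_mirrorForm_cprod_le G r hβ c b L hc0 hcL (fun y => g (s • siteToE y)) (fun z => h (s • siteToE z))
    (fun x => v (s • siteToE x)) (fun y _ hy => (hg y hy).2) (fun z _ hz => (hh z hz).2)
  have hX := mirrorForm_cubeSmear_self_nonneg G r hβ c b L hc0 hcL (fun x => v (s • siteToE x))
  rw [← hid] at hcs
  exact floor_transfer_arith hε₃ hfloor hcs hceil hX


end Transfer

end Summit.QuantumFields.YangMills.Cruxes.NT.CumulantPolarisation

end
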